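import Summits.BirchSwinnertonDyer.Rank1Residual.Additive.GordTorsionAnomalous
import Summits.BirchSwinnertonDyer.Rank1Residual.Additive.ReductionPointCountIsogeny
import Summits.BirchSwinnertonDyer.Rank1Residual.Additive.GordIsogenyInvariance
import HarnessLib

/-!
# The torsion exception is anomalous — CLASS LEVEL: a rational `p`-torsion point on ANY curve of
# the `ℚ`-isogeny class makes the whole (G)-class anomalous; a non-anomalous (G)-class is
# `p`-torsion-free member by member

HONEST FRAMING (cell `b2b-bsdres`, run/shared/lean/b2b/bsd-rank1-residual/, verbatim in every
file): the goal of the cell is to DELETE the COMBINATION-SHAPED residual classes of the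
Birch–Swinnerton-Dyer formula for ALL analytic-rank `≤ 1` elliptic curves over `ℚ` — "full BSD
formula for every rank `≤ 1` curve in class `C`" assembled STRICTLY from published theorems — so
that the rank-`≤ 1` remainder becomes exactly the CONSTRUCTION-SHAPED classes, which are TYPED
(missing-input `Prop`s), NOT attempted. This is not "finishing BSD". Sub-cell `additive-p2`
(X3♯(G-ord) / X4♯(G-ord)), generation 38: research route; no claim beyond the stated classes;
theorems only, no definition, no named fact, nothing booked, no label moved.

## What and why

`Additive/GordTorsionAnomalous` (generation 38): on the (G)-cell a `ℚ_p`-rational `p`-torsion point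
of `E` itself forces `¬ ReductionNonAnomalous W p`.  In Cremona's table the `p`-torsion usually sits
on a `p`-ISOGENOUS member of the class, not on the optimal curve the census reads (window: 13
classes — 150a1, 175a1, …, 294b1, 490k1 — none of whose optimal curves carries the torsion).  With
`Additive/ReductionPointCountIsogeny` (`ReductionNonAnomalous` is a `ℚ`-isogeny-class invariant,
from the isogeny invariance of `#Ẽ_v(k_v)` over number fields) and generation 15
(`TypeG`, `Addv` are class invariants on the (G)-cell) the statement becomes class-level:

* **`TypeG.not_reductionNonAnomalous_of_isIsogenous_of_prime_zsmul_eq_zero`** — `W ∼ W'` over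
  `ℚ` (`W'` globally minimal), `(W, p)` of type (G) and additive, `p ≥ 5`, and a `ℚ_p`-point
  `P' ≠ O` of `W'` with `p • P' = O` ⟹ `¬ ReductionNonAnomalous W p`;
* **`TypeG.eq_zero_of_prime_nsmul_eq_zero_of_isIsogenous_of_reductionNonAnomalous`** — conversely
  a non-anomalous (G)-pair has `E'(ℚ_p)[p] = 0` and `p ∤ #E'(ℚ)_tors` for EVERY `E' ∼ E`
  (`…padicValNat_torsionOrder_eq_zero_of_isIsogenous_of_reductionNonAnomalous`); class forms for
  X3♯(G-ord)/X4♯(G-ord).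

EVIDENCE (`gen38/TORSION-ANOMALOUS-READING.md`): whole ecdata table, 113 (class, p) pairs with a
(G)-member and a `p`-torsion member — every member on the anomalous residue, 113/113; window
13/13 anomalous over F₀ by PARI point counts.

References: [Delbourgo2002] D. Delbourgo, J. Number Theory 95 (2002), p. 39 (`ℓ_p(E)`);
[Faltings1983Endlichkeit] §5 Korollar 2; [SilvermanAEC2009] Cor. VII.7.2, C.21.3;
[Mazur1977] Ch. III §5, Step 1, p. 158.
-/

noncomputable section

open scoped Classical NumberField

namespace Summit.BirchSwinnertonDyer.Rank1Residual.Additive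

open WeierstrassCurve IsDedekindDomain IsDedekindDomain.HeightOneSpectrum NumberField IsLocalRing
  Literature.NumberTheory.EllipticCurves Literature.NumberTheory.EllipticCurves.Rank1Residual

variable {W W' : WeierstrassCurve ℚ} [W.IsElliptic] [W'.IsElliptic] [W'.IsGloballyMinimal] {p : ℕ}
  [hp : Fact p.Prime]

/-- **A `p`-torsion point ANYWHERE in the class makes the (G)-class anomalous**: `W ∼ W'` over `ℚ`,
`TypeG W p`, `Addv W p`, `p ≥ 5`, `P' ∈ W'(ℚ_p)`, `P' ≠ O`, `p • P' = O` ⟹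
`¬ ReductionNonAnomalous W p`. [cite: Delbourgo2002, p. 39 (definition of ℓ_p(E)); Mazur1977, Ch. III §5, Step 1, p. 158] -/
theorem TypeG.not_reductionNonAnomalous_of_isIsogenous_of_prime_zsmul_eq_zero
    (h : IsIsogenous W W') (hG : TypeG W p) (hp5 : 5 ≤ p) (hadd : Addv W p)
    {P : (W'.baseChange ℚ_[p]).toAffine.Point} (hP0 : P ≠ 0) (hP : (p : ℤ) • P = 0) :
    ¬ Delbourgo2002.ReductionNonAnomalous W p := by
  rw [reductionNonAnomalous_iff_of_isIsogenous p h]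
  exact (hG.of_isIsogenous h).not_reductionNonAnomalous_of_prime_zsmul_eq_zero hp5
    (Addv.of_isIsogenous_of_typeG hadd hG h) hP0 hP

/-- **A non-anomalous (G)-class is `p`-torsion-free member by member, locally**: `W ∼ W'`,
`TypeG W p`, `Addv W p`, `p ≥ 5`, `ReductionNonAnomalous W p` ⟹ `E'(ℚ_p)[p] = 0`.
[cite: Delbourgo2002, p. 39 (definition of ℓ_p(E)); Mazur1977, Ch. III §5, Step 1, p. 158] -/
theorem TypeG.eq_zero_of_prime_nsmul_eq_zero_of_isIsogenous_of_reductionNonAnomalous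
    (h : IsIsogenous W W') (hG : TypeG W p) (hp5 : 5 ≤ p) (hadd : Addv W p)
    (hR : Delbourgo2002.ReductionNonAnomalous W p) {P : (W'.baseChange ℚ_[p]).toAffine.Point}
    (hP : p • P = 0) : P = 0 := by
  by_contra hP0
  exact hG.not_reductionNonAnomalous_of_isIsogenous_of_prime_zsmul_eq_zero h hp5 hadd hP0
    (by rw [natCast_zsmul]; exact hP) hR

/-- **… and rationally: `p ∤ #E'(ℚ)_tors` for every `E' ∼ E`** in a non-anomalous (G)-class
(`p ≥ 5`). [cite: Delbourgo2002, p. 39 (definition of ℓ_p(E)); Mazur1977, Ch. III §5, Step 1, p. 158] -/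
theorem TypeG.padicValNat_torsionOrder_eq_zero_of_isIsogenous_of_reductionNonAnomalous
    (h : IsIsogenous W W') (hG : TypeG W p) (hp5 : 5 ≤ p) (hadd : Addv W p)
    (hR : Delbourgo2002.ReductionNonAnomalous W p) : padicValNat p W'.torsionOrder = 0 :=
  padicValNat.eq_zero_of_not_dvd (not_dvd_torsionOrder_of_noPTorsion W' p
    (fun _ hQ => hG.eq_zero_of_prime_nsmul_eq_zero_of_isIsogenous_of_reductionNonAnomalous h hp5
      hadd hR hQ))

/-- **X3♯(G-ord), class level**: `W ∼ W'`, `ClassX3Gord W p`, `p ≥ 5`, a `ℚ_p`-rational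
`p`-torsion point on `W'` ⟹ the row `(W, p)` is anomalous (`¬ ReductionNonAnomalous W p`) — the
13 window classes 150a1, …, 490k1 of the census. [cite: Delbourgo2002, p. 39 (definition of ℓ_p(E)); Delbourgo1998, §1.5] -/
theorem ClassX3Gord.not_reductionNonAnomalous_of_isIsogenous_of_prime_zsmul_eq_zero
    (h : IsIsogenous W W') (hX : ClassX3Gord W p) (hp5 : 5 ≤ p)
    {P : (W'.baseChange ℚ_[p]).toAffine.Point} (hP0 : P ≠ 0) (hP : (p : ℤ) • P = 0) :
    ¬ Delbourgo2002.ReductionNonAnomalous W p :=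
  hX.2.typeG.not_reductionNonAnomalous_of_isIsogenous_of_prime_zsmul_eq_zero h hp5 hX.1.2 hP0 hP

/-- **X4♯(G-ord), class level**: the same on the irreducible half.
[cite: Delbourgo2002, p. 39 (definition of ℓ_p(E)); Delbourgo1998, §1.5] -/
theorem ClassX4Gord.not_reductionNonAnomalous_of_isIsogenous_of_prime_zsmul_eq_zero
    (h : IsIsogenous W W') (hX : ClassX4Gord W p) (hp5 : 5 ≤ p)
    {P : (W'.baseChange ℚ_[p]).toAffine.Point} (hP0 : P ≠ 0) (hP : (p : ℤ) • P = 0) :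
    ¬ Delbourgo2002.ReductionNonAnomalous W p :=
  hX.2.typeG.not_reductionNonAnomalous_of_isIsogenous_of_prime_zsmul_eq_zero h hp5 hX.1.2.1 hP0 hP

/-- **X3♯(G-ord) off the anomalous rows: every curve of the class has `p ∤ #E'(ℚ)_tors`** (`p ≥ 5`).
[cite: Delbourgo2002, p. 39 (definition of ℓ_p(E)); Delbourgo1998, §1.5] -/
theorem ClassX3Gord.padicValNat_torsionOrder_eq_zero_of_isIsogenous_of_reductionNonAnomalous
    (h : IsIsogenous W W') (hX : ClassX3Gord W p) (hp5 : 5 ≤ p)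
    (hR : Delbourgo2002.ReductionNonAnomalous W p) : padicValNat p W'.torsionOrder = 0 :=
  hX.2.typeG.padicValNat_torsionOrder_eq_zero_of_isIsogenous_of_reductionNonAnomalous h hp5 hX.1.2 hR

/-- **X4♯(G-ord) off the anomalous rows: every curve of the class has `p ∤ #E'(ℚ)_tors`** (`p ≥ 5`).
[cite: Delbourgo2002, p. 39 (definition of ℓ_p(E)); Delbourgo1998, §1.5] -/
theorem ClassX4Gord.padicValNat_torsionOrder_eq_zero_of_isIsogenous_of_reductionNonAnomalous
    (h : IsIsogenous W W') (hX : ClassX4Gord W p) (hp5 : 5 ≤ p)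
    (hR : Delbourgo2002.ReductionNonAnomalous W p) : padicValNat p W'.torsionOrder = 0 :=
  hX.2.typeG.padicValNat_torsionOrder_eq_zero_of_isIsogenous_of_reductionNonAnomalous h hp5
    hX.1.2.1 hR

/-! ## The special fibre over `ℚ(ζ₅)` of a III@5 class with rational `5`-torsion has exactly 10 points -/

/-- **A rational `5`-torsion point on a (G)-pair at `5` gives `#Ẽ_𝔭(𝔽₅) = 10` EXACTLY** at the prime
`𝔭 ∋ 5` of any `5`-th cyclotomic field where `E_K` is good (`Additive/GordTorsionAnomalous`:
`5 ∣ #Ẽ_𝔭`; gen 35: for `j̃ = 1728` over `𝔽₅`, `5 ∣ #Ẽ ⟺ #Ẽ = 10`; gen 37: the pair is III, `e = 4`,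
so `j̃ = 1728`). [cite: IrelandRosen1990, Ch. 18 §4, Theorem 5; Delbourgo2002, p. 39 (definition of ℓ_p(E))] -/
theorem TypeG.natCard_point_reductionAt_eq_ten_of_prime_zsmul_eq_zero [h5 : Fact (Nat.Prime 5)]
    [W.IsGloballyMinimal] (hG : TypeG W 5) (hadd : Addv W 5)
    {P : (W.baseChange ℚ_[5]).toAffine.Point} (hP0 : P ≠ 0) (hP : ((5 : ℕ) : ℤ) • P = 0)
    {K : Type} [Field K] [NumberField K] [IsCyclotomicExtension {5} ℚ K]
    {𝔭 : HeightOneSpectrum (𝓞 K)} (h𝔭 : ((5 : ℕ) : 𝓞 K) ∈ 𝔭.asIdeal)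
    (hgood : (W.baseChange K).HasGoodReductionAt 𝔭) :
    Nat.card ((W.baseChange K).reductionAt 𝔭).toAffine.Point = 10 := by
  have h5dvd := hG.five_dvd_natCard_point_reductionAt_of_prime_zsmul_eq_zero hadd hP0 hP h𝔭 hgood
  have he : semistabilityIndex W 5 = 4 := by
    rcases hG.residue_of_prime_zsmul_eq_zero le_rfl hadd hP0 hP with ⟨-, he, -⟩ | ⟨h7, -⟩
    · exact he
    · exact absurd h7 (by norm_num)
  haveI : (W.baseChange K).IsElliptic := by rw [baseChange]; infer_instance
  haveI : ((W.baseChange K).reductionAt 𝔭).IsElliptic := isElliptic_reductionAt hgood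
  obtain ⟨𝔭₀, -, huniq, hN⟩ := exists_prime_over_prime 5 K
  have h𝔭₀ : 𝔭 = 𝔭₀ := by
    have : 𝔭 ∈ ({𝔭₀} : Set (HeightOneSpectrum (𝓞 K))) := by rw [← huniq]; exact_mod_cast h𝔭
    exact this
  subst h𝔭₀
  have hcard := natCard_residueField_adicCompletionIntegers_eq_of_absNorm 𝔭 hN
  have hj : ((W.baseChange K).reductionAt 𝔭).j = 1728 :=
    reductionAt_j_eq_of_valuation_lt_one (W.baseChange K) 𝔭 hgood
      (valuation_j_sub_lt_one_of_semistabilityIndex_eq_four W 5 le_rfl he h𝔭 hgood)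
  exact (SpecialJ.five_dvd_natCard_point_iff_of_j_eq _ hcard hj).mp h5dvd

end Summit.BirchSwinnertonDyer.Rank1Residual.Additive

end
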